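import Summits.QuantumFields.YangMills.Theorems.UnitScaleTiltProp7GaugeDirRotationDivergenceL2
import Summits.QuantumFields.YangMills.Theorems.UnitScaleTiltProp7ChartVelocityDexp
import HarnessLib

/-!
# Route `UnitScaleTilt`, crux K1 child «MinimiserStabilityRegPr» (stmt-QuantumFields-19200), skeleton v10, stub `stub_existenceMinimalOrbit` (EX), route (α) —
# **THE ROTATION ROW OF THE TRANSFER SUPPLIER (hS) OF ✓`Prop7LandauTransversalityPairing.htest_of_suppliers`, COMPLETE: `‖D*_{U₀}(toL2 w + η·D_{U₀}(toL2S N))‖ ≤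
# e^{εη}e^{εη}·ε·η·((12 + 100ε)‖toL2S N‖ + 28‖D_{U₀}(toL2S N)‖)`** for the consumer's pulled gauge direction `w = g(ad(−A))⁻¹·Gd N` at `U′ = e^{A}U₀` (`Gd N(b) = N(b₋) − U′(b)N(b₊)U′(b)⁻¹`),
# under clauses 1–2 of (19) for `A` (`‖A(b)‖ ≤ εη ≤ ¼`, DIAGONAL covariant gradients `≤ εη²`): the identity `toL2 w + η·D N = toL2(w − Gd N) − toL2(rot N)` (`Gd N + η·D_{U₀}N = −rot N`, stencil
# (3.3)), the VELOCITY DEFECT `‖w − Gd N‖ ≤ 4εη·‖Gd N‖` (`‖g(ad(−A))⁻¹ − 1‖ ≤ e^{2εη} − 1`, ✓`Prop7ChartVelocityDexp.norm_gSer_ad_neg_sub_one_le`∕`isUnit_gSer_ad_neg`, no regularity needed) with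
# the crude divergence bound `‖D*(toL2 Z)‖ ≤ 5η⁻¹·(ℓ²-op size of Z)`, and (E1) ✓`norm_DstarL2_rot_le` for the rotation.

Cell `ym3-torus`, width seat `ym-ust-20520-w5` (gen 7).  THEOREMS ONLY (0 `def`, 0 `sorry`).  `--supports stmt-QuantumFields-19200 --as helper`, count-neutral.  YM₃ on T³ is a
ladder rung (R3), not the Clay problem; nothing here claims the stub, the crux, d = 4 or the mass gap.

WHAT IS PROVED (sorry-free, no definition; ns `…Theorems.Prop7GaugeDirRotationDivergence`):
* §1 `bnegEquiv_apply`∕`sum_bneg_eq_sum_bond` (the backward bonds `(x − e_μ, x)` re-index the bonds), `norm_DstarPi_le` (‖(D*Z)(x)‖ ≤ η⁻¹Σ_μ(‖Z(b⁻)‖ + ‖Z(b⁺)‖)),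
  ★`norm_DstarL2_le_of_pointwise` (`‖Z(b)‖ ≤ θ‖Y(b)‖` ⟹ `‖D*(toL2 Z)‖ ≤ 5θη⁻¹‖toL2 Y‖`).
* §2 ★`norm_velocityDefect_le` (`g(ad(−A))w = y`, `‖A‖ ≤ r ≤ ¼` ⟹ `‖w − y‖ ≤ 4r‖y‖`).
* §3 `norm_rot_le` (pointwise `‖rot N(b)‖ ≤ 2e^{εη}e^{εη}·εη·‖N(b₊)‖`), `sum_normSq_tgt` (`Σ_b‖N(b₊)‖² = 3Σ_x‖N x‖²`), ★`norm_toL2_rot_le` (`‖toL2(rot N)‖ ≤ 5e^{εη}e^{εη}·εη·‖toL2S N‖`).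
* §4 `gaugeDir_add_eta_smul_eq_neg_rot` (the identity), ★★★`norm_DstarL2_transfer_le` (the displayed row).
HONEST SCOPE.  L² bookkeeping over landed letters with crude integer constants; the transfer-smallness half of (hS) (`N′ − l₁` small in `H⁰, H¹, H²`: R2t + R2q″) is NOT here; nothing of print asserted.

References: T. Bałaban, CMP 99 (1985) 389–434 [Balaban1985BackgroundPropagators] ((3.3) p.391, (3.8) p.392, (3.11) p.392); CMP 102 (1985) 277–309 [Balaban1985Variational] ((19) p.281, (47)–(51) pp.285–286).
-/

set_option autoImplicit false

noncomputable section

open scoped Matrix.Norms.L2Operator BigOperators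
open NormedSpace

namespace Summit.QuantumFields.YangMills.Theorems.Prop7GaugeDirRotationDivergence

open Literature.MathematicalPhysics.QuantumFieldTheory.Balaban1983to89
open Literature.MathematicalPhysics.QuantumFieldTheory.Balaban1983to89.T3ContinuumYM3Torus
open Literature.MathematicalPhysics.QuantumFieldTheory.Balaban1983to89.T3SectALandauChart (eta eta_pos bgUnits covGradT)
open B9SectCLatticeCarrier (unshift shift_unshift unshift_shift)
open Summit.QuantumFields.YangMills.Theorems.Prop7SectET3Transport (periodsT3 siteEquiv bondEquiv bgOfCfg bondEquiv_symm_apply siteEquiv_shift siteEquiv_symm_shift val_bgOfCfg isUnitaryBg_bgOfCfg)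
open Summit.QuantumFields.YangMills.Theorems.Prop7SectET3HilbertLetters (W₂ toL2 toL2S DL2 DstarL2 DL2_apply DstarL2_apply)
open Summit.QuantumFields.YangMills.Theorems.Prop7SectET3GaugeProjector (DstarPi DstarPi_apply)
open Summit.QuantumFields.YangMills.Theorems.Prop7LandauDict (bondEquiv_symm_siteEquiv)
open Summit.QuantumFields.YangMills.Theorems.Prop7NestedMeanPoincare (normSq_toL2S_eq normSq_toL2_eq normSq_toL2S_le_two_mul)
open Summit.QuantumFields.YangMills.Theorems.Prop7CovariantCoercivity (sum_norm_sq_le_mul_opNorm_sq)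
open Summit.QuantumFields.YangMills.Theorems.Prop7ChartVelocityDexp (isUnit_gSer_ad_neg norm_gSer_ad_neg_sub_one_le)
open Literature.Analysis.Calculus.ExpDifferential (ad gSer)

variable (F : T3Family) {n K : ℕ} {c₀ : ℝ} [Fact (0 < c₀)]

/-! ## §1 The backward-bond re-indexing and the crude divergence bound -/

/-- The backward step `x ↦ x − e_μ` as a permutation of the sites of the member (inverse `x ↦ x + e_μ`). [folklore] -/
theorem bnegEquiv_exists (μ : Fin 3) :
    ∃ e : Site (F.P K) 0 ≃ Site (F.P K) 0, ∀ x, e x = (siteEquiv F K).symm (unshift μ (siteEquiv F K x)) := by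
  refine ⟨⟨fun x => (siteEquiv F K).symm (unshift μ (siteEquiv F K x)), fun x => x.shift μ, fun x => shift_bneg F x μ, fun x => ?_⟩, fun x => rfl⟩
  show (siteEquiv F K).symm (unshift μ (siteEquiv F K (x.shift μ))) = x
  rw [siteEquiv_shift, unshift_shift, Equiv.symm_apply_apply]

/-- **THE BACKWARD BONDS RE-INDEX THE BONDS**: `Σ_x Σ_μ g(b⁻_μ(x)) = Σ_b g b`, `b⁻_μ(x) = (x − e_μ, x)`. [folklore] -/
theorem sum_bneg_eq_sum_bond (g : PBond (F.P K) 0 → ℝ) :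
    ∑ x : Site (F.P K) 0, ∑ μ : Fin 3, g ((bondEquiv F K).symm (unshift μ (siteEquiv F K x), μ)) = ∑ b : PBond (F.P K) 0, g b := by
  have hB : (∑ x : Site (F.P K) 0, ∑ μ : Fin 3, g ⟨x, μ⟩) = ∑ b : PBond (F.P K) 0, g b := sum_site_dir_eq_sum_bond F g
  rw [← hB]
  calc ∑ x : Site (F.P K) 0, ∑ μ : Fin 3, g ((bondEquiv F K).symm (unshift μ (siteEquiv F K x), μ))
      = ∑ μ : Fin 3, ∑ x : Site (F.P K) 0, g ((bondEquiv F K).symm (unshift μ (siteEquiv F K x), μ)) := Finset.sum_comm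
    _ = ∑ μ : Fin 3, ∑ x : Site (F.P K) 0, g ⟨x, μ⟩ := by
        refine Finset.sum_congr rfl fun μ _ => ?_
        obtain ⟨e, he⟩ := bnegEquiv_exists F (K := K) μ
        refine Fintype.sum_equiv e _ _ fun x => ?_
        rw [bneg_eq, ← he]
    _ = ∑ x : Site (F.P K) 0, ∑ μ : Fin 3, g ⟨x, μ⟩ := Finset.sum_comm

/-- **THE CRUDE POINTWISE DIVERGENCE BOUND**: `‖(D*_{U₀}Z)(x)‖ ≤ η⁻¹·Σ_μ(‖Z(b⁻_μ(x))‖ + ‖Z(x, x+e_μ)‖)` (stencil (3.8), `‖U₀(b)⋆ Z U₀(b)‖ = ‖Z‖`). [cite: Balaban1985BackgroundPropagators, (3.8) p.392] -/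
theorem norm_DstarPi_le (U₀ : GaugeField (F.P K) 0 (Matrix.specialUnitaryGroup (Fin 2) ℂ)) (Z : PBond (F.P K) 0 → Matrix (Fin 2) (Fin 2) ℂ) (x : Site (F.P K) 0) :
    ‖DstarPi F n K c₀ U₀ Z x‖ ≤ (eta F n K)⁻¹ * ∑ μ : Fin 3, (‖Z ((bondEquiv F K).symm (unshift μ (siteEquiv F K x), μ))‖ + ‖Z ⟨x, μ⟩‖) := by
  have hη : 0 < eta F n K := eta_pos F n K
  rw [DstarPi_apply, DstarL2_apply, norm_smul, norm_inv, Complex.norm_real, Real.norm_of_nonneg hη.le]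
  refine mul_le_mul_of_nonneg_left ((norm_sum_le _ _).trans (Finset.sum_le_sum fun μ _ => ?_)) (inv_nonneg.2 hη.le)
  rw [coe_bgOfCfg_inv, val_bgOfCfg, bondEquiv_symm_siteEquiv F K x μ]
  set bm : PBond (F.P K) 0 := (bondEquiv F K).symm (unshift μ (siteEquiv F K x), μ) with hbm
  have hn := norm_coe_bg F U₀ bm
  calc ‖star (((U₀ bm : Matrix.specialUnitaryGroup (Fin 2) ℂ)) : Matrix (Fin 2) (Fin 2) ℂ) * Z bm * ((U₀ bm : Matrix.specialUnitaryGroup (Fin 2) ℂ) : Matrix (Fin 2) (Fin 2) ℂ) - Z ⟨x, μ⟩‖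
      ≤ ‖star (((U₀ bm : Matrix.specialUnitaryGroup (Fin 2) ℂ)) : Matrix (Fin 2) (Fin 2) ℂ) * Z bm * ((U₀ bm : Matrix.specialUnitaryGroup (Fin 2) ℂ) : Matrix (Fin 2) (Fin 2) ℂ)‖ + ‖Z ⟨x, μ⟩‖ :=
        norm_sub_le _ _
    _ ≤ ‖star (((U₀ bm : Matrix.specialUnitaryGroup (Fin 2) ℂ)) : Matrix (Fin 2) (Fin 2) ℂ)‖ * ‖Z bm‖ * ‖((U₀ bm : Matrix.specialUnitaryGroup (Fin 2) ℂ) : Matrix (Fin 2) (Fin 2) ℂ)‖ + ‖Z ⟨x, μ⟩‖ := by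
        gcongr; exact norm_mul₃_le
    _ = ‖Z bm‖ + ‖Z ⟨x, μ⟩‖ := by rw [hn.1, hn.2, one_mul, mul_one]

/-- ★ **THE CRUDE `L²` DIVERGENCE BOUND UNDER A POINTWISE COMPARISON**: if `‖Z(b)‖ ≤ θ·‖Y(b)‖` at every bond (operator norms, `0 ≤ θ`), then `‖D*_{U₀}(toL2 Z)‖ ≤ 5θη⁻¹·‖toL2 Y‖`
(`(Σ of 6)² ≤ 6Σ²`, both bond re-indexings, operator ≤ Frobenius; `√24 ≤ 5`). [cite: Balaban1985BackgroundPropagators, (3.8) p.392, (3.11) p.392] -/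
theorem norm_DstarL2_le_of_pointwise (U₀ : GaugeField (F.P K) 0 (Matrix.specialUnitaryGroup (Fin 2) ℂ)) (Z Y : PBond (F.P K) 0 → Matrix (Fin 2) (Fin 2) ℂ) {θ : ℝ} (hθ : 0 ≤ θ)
    (hZY : ∀ b, ‖Z b‖ ≤ θ * ‖Y b‖) :
    ‖DstarL2 F n K c₀ U₀ (toL2 F K c₀ Z)‖ ≤ 5 * θ * (eta F n K)⁻¹ * ‖toL2 F K c₀ Y‖ := by
  have hc : 0 < c₀ := Fact.out
  have hη : 0 < eta F n K := eta_pos F n K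
  have hread : DstarL2 F n K c₀ U₀ (toL2 F K c₀ Z) = toL2S F K c₀ (DstarPi F n K c₀ U₀ Z) := by rw [DstarPi_apply, LinearEquiv.apply_symm_apply]
  set S : ℝ := c₀ * ∑ b : PBond (F.P K) 0, ‖Y b‖ ^ 2 with hS
  have hSle : S ≤ ‖toL2 F K c₀ Y‖ ^ 2 := by
    rw [hS, normSq_toL2_eq]
    exact mul_le_mul_of_nonneg_left (Finset.sum_le_sum fun b _ => MatrixNorms.opNorm_sq_le_sum_norm_sq (Y b)) hc.le
  -- pointwise squares
  have hpt : ∀ x : Site (F.P K) 0, ‖DstarPi F n K c₀ U₀ Z x‖ ^ 2 ≤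
      (eta F n K)⁻¹ ^ 2 * (θ ^ 2 * (6 * ∑ μ : Fin 3, (‖Y ((bondEquiv F K).symm (unshift μ (siteEquiv F K x), μ))‖ ^ 2 + ‖Y ⟨x, μ⟩‖ ^ 2))) := by
    intro x
    have h1 := norm_DstarPi_le F (n := n) (c₀ := c₀) U₀ Z x
    have h2 : ∑ μ : Fin 3, (‖Z ((bondEquiv F K).symm (unshift μ (siteEquiv F K x), μ))‖ + ‖Z ⟨x, μ⟩‖)
        ≤ θ * ∑ μ : Fin 3, (‖Y ((bondEquiv F K).symm (unshift μ (siteEquiv F K x), μ))‖ + ‖Y ⟨x, μ⟩‖) := by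
      rw [Finset.mul_sum]
      exact Finset.sum_le_sum fun μ _ => by rw [mul_add]; exact add_le_add (hZY _) (hZY _)
    have h3 : (∑ μ : Fin 3, (‖Y ((bondEquiv F K).symm (unshift μ (siteEquiv F K x), μ))‖ + ‖Y ⟨x, μ⟩‖)) ^ 2
        ≤ 6 * ∑ μ : Fin 3, (‖Y ((bondEquiv F K).symm (unshift μ (siteEquiv F K x), μ))‖ ^ 2 + ‖Y ⟨x, μ⟩‖ ^ 2) := by
      have hcs := sq_sum_le_card_mul_sum_sq (s := (Finset.univ : Finset (Fin 3)))
        (f := fun μ => ‖Y ((bondEquiv F K).symm (unshift μ (siteEquiv F K x), μ))‖ + ‖Y ⟨x, μ⟩‖)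
      simp only [Finset.card_univ, Fintype.card_fin] at hcs
      refine hcs.trans ?_
      rw [show ((3 : ℕ) : ℝ) = 3 by norm_num, Finset.mul_sum, Finset.mul_sum]
      refine Finset.sum_le_sum fun μ _ => ?_
      nlinarith [sq_nonneg (‖Y ((bondEquiv F K).symm (unshift μ (siteEquiv F K x), μ))‖ - ‖Y ⟨x, μ⟩‖)]
    have h4 : 0 ≤ ∑ μ : Fin 3, (‖Z ((bondEquiv F K).symm (unshift μ (siteEquiv F K x), μ))‖ + ‖Z ⟨x, μ⟩‖) := Finset.sum_nonneg fun μ _ => by positivity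
    calc ‖DstarPi F n K c₀ U₀ Z x‖ ^ 2 ≤ ((eta F n K)⁻¹ * ∑ μ : Fin 3, (‖Z ((bondEquiv F K).symm (unshift μ (siteEquiv F K x), μ))‖ + ‖Z ⟨x, μ⟩‖)) ^ 2 :=
          pow_le_pow_left₀ (norm_nonneg _) h1 2
      _ ≤ ((eta F n K)⁻¹ * (θ * ∑ μ : Fin 3, (‖Y ((bondEquiv F K).symm (unshift μ (siteEquiv F K x), μ))‖ + ‖Y ⟨x, μ⟩‖))) ^ 2 := by
          gcongr
      _ = (eta F n K)⁻¹ ^ 2 * (θ ^ 2 * (∑ μ : Fin 3, (‖Y ((bondEquiv F K).symm (unshift μ (siteEquiv F K x), μ))‖ + ‖Y ⟨x, μ⟩‖)) ^ 2) := by ring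
      _ ≤ (eta F n K)⁻¹ ^ 2 * (θ ^ 2 * (6 * ∑ μ : Fin 3, (‖Y ((bondEquiv F K).symm (unshift μ (siteEquiv F K x), μ))‖ ^ 2 + ‖Y ⟨x, μ⟩‖ ^ 2))) := by
          gcongr
  -- sum over the torus
  have hsq : ‖DstarL2 F n K c₀ U₀ (toL2 F K c₀ Z)‖ ^ 2 ≤ 24 * θ ^ 2 * (eta F n K)⁻¹ ^ 2 * S := by
    rw [hread]
    calc ‖toL2S F K c₀ (DstarPi F n K c₀ U₀ Z)‖ ^ 2 ≤ 2 * c₀ * ∑ x : Site (F.P K) 0, ‖DstarPi F n K c₀ U₀ Z x‖ ^ 2 := normSq_toL2S_le_two_mul F _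
      _ ≤ 2 * c₀ * ∑ x : Site (F.P K) 0, (eta F n K)⁻¹ ^ 2 * (θ ^ 2 * (6 * ∑ μ : Fin 3, (‖Y ((bondEquiv F K).symm (unshift μ (siteEquiv F K x), μ))‖ ^ 2 + ‖Y ⟨x, μ⟩‖ ^ 2))) := by
          gcongr with x _; exact hpt x
      _ = 12 * θ ^ 2 * (eta F n K)⁻¹ ^ 2 * (c₀ * (∑ x : Site (F.P K) 0, ∑ μ : Fin 3, ‖Y ((bondEquiv F K).symm (unshift μ (siteEquiv F K x), μ))‖ ^ 2
            + ∑ x : Site (F.P K) 0, ∑ μ : Fin 3, ‖Y ⟨x, μ⟩‖ ^ 2)) := by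
          rw [← Finset.mul_sum, ← Finset.mul_sum, ← Finset.mul_sum]
          simp only [Finset.sum_add_distrib]
          ring
      _ = 24 * θ ^ 2 * (eta F n K)⁻¹ ^ 2 * S := by
          have hA : (∑ x : Site (F.P K) 0, ∑ μ : Fin 3, ‖Y ((bondEquiv F K).symm (unshift μ (siteEquiv F K x), μ))‖ ^ 2) = ∑ b : PBond (F.P K) 0, ‖Y b‖ ^ 2 :=
            sum_bneg_eq_sum_bond F (fun b => ‖Y b‖ ^ 2)
          have hB : (∑ x : Site (F.P K) 0, ∑ μ : Fin 3, ‖Y ⟨x, μ⟩‖ ^ 2) = ∑ b : PBond (F.P K) 0, ‖Y b‖ ^ 2 := sum_site_dir_eq_sum_bond F (fun b => ‖Y b‖ ^ 2)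
          rw [hA, hB, hS]; ring
  have hrhs : 24 * θ ^ 2 * (eta F n K)⁻¹ ^ 2 * S ≤ (5 * θ * (eta F n K)⁻¹ * ‖toL2 F K c₀ Y‖) ^ 2 := by
    have h0 : 0 ≤ θ ^ 2 * (eta F n K)⁻¹ ^ 2 := by positivity
    have hS0 : 0 ≤ S := by rw [hS]; positivity
    nlinarith [mul_le_mul_of_nonneg_left hSle h0, mul_nonneg h0 hS0]
  have hnn : 0 ≤ 5 * θ * (eta F n K)⁻¹ * ‖toL2 F K c₀ Y‖ := by positivity
  exact (pow_le_pow_iff_left₀ (norm_nonneg _) hnn two_ne_zero).1 (hsq.trans hrhs)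

/-! ## §2 The velocity defect `‖g(ad(−A))⁻¹y − y‖ ≤ 4‖A‖·‖y‖` -/

/-- ★ **THE VELOCITY DEFECT**: if `g(ad(−A))w = y` with `‖A‖ ≤ r ≤ ¼`, then `‖w − y‖ ≤ 4r·‖y‖` (`‖g(ad(−A)) − 1‖ ≤ (e^{2r} − 1)∕2 ≤ ½` ✓`norm_gSer_ad_neg_sub_one_le`, the unit's inverse is within
`2·‖g − 1‖ ≤ e^{2r} − 1 ≤ 4r` of `1`, lit `B7Prop6Flat.norm_units_inv_sub_one_le`, Mathlib `Real.abs_exp_sub_one_le`). No regularity of `A` beyond its size is used.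
[cite: Balaban1985Variational, (47)–(49) p.285] -/
theorem norm_velocityDefect_le {𝔸 : Type*} [NormedRing 𝔸] [NormedAlgebra ℂ 𝔸] [CompleteSpace 𝔸] [NormOneClass 𝔸] {A w y : 𝔸} {r : ℝ} (hA : ‖A‖ ≤ r) (hr : r ≤ 1 / 4)
    (h : gSer ℂ (ad ℂ (-A)) w = y) : ‖w - y‖ ≤ 4 * r * ‖y‖ := by
  have hr0 : 0 ≤ r := (norm_nonneg A).trans hA
  have hA2 : ‖A‖ ≤ 1 / 2 := hA.trans (hr.trans (by norm_num))
  obtain ⟨u, hu⟩ := isUnit_gSer_ad_neg (𝔸 := 𝔸) hA2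
  -- `‖u − 1‖ ≤ (e^{2r} − 1)/2 ≤ 1/2`
  have hexp : Real.exp (2 * r) - 1 ≤ 4 * r := by
    have h1 : |2 * r| ≤ 1 := by rw [abs_of_nonneg (by linarith)]; linarith
    have h2 := Real.abs_exp_sub_one_le h1
    rw [abs_of_nonneg (by linarith : (0:ℝ) ≤ 2 * r)] at h2
    exact (le_abs_self _).trans (h2.trans (le_of_eq (by ring)))
  have hu1 : ‖(u : 𝔸 →L[ℂ] 𝔸) - 1‖ ≤ (Real.exp (2 * r) - 1) / 2 := by
    rw [hu]
    refine (norm_gSer_ad_neg_sub_one_le A).trans ?_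
    gcongr
  have hu1' : ‖(u : 𝔸 →L[ℂ] 𝔸) - 1‖ ≤ 1 / 2 := hu1.trans (by linarith)
  have hui : ‖((u⁻¹ : (𝔸 →L[ℂ] 𝔸)ˣ) : 𝔸 →L[ℂ] 𝔸) - 1‖ ≤ 4 * r :=
    (B7Prop6Flat.norm_units_inv_sub_one_le u hu1').trans (by linarith)
  -- `w = u⁻¹ y`
  have hw : w = ((u⁻¹ : (𝔸 →L[ℂ] 𝔸)ˣ) : 𝔸 →L[ℂ] 𝔸) y := by
    have h1 : (u : 𝔸 →L[ℂ] 𝔸) w = y := by rw [hu]; exact h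
    have h2 : ((u⁻¹ : (𝔸 →L[ℂ] 𝔸)ˣ) : 𝔸 →L[ℂ] 𝔸) ((u : 𝔸 →L[ℂ] 𝔸) w) = (((u⁻¹ : (𝔸 →L[ℂ] 𝔸)ˣ) : 𝔸 →L[ℂ] 𝔸) * (u : 𝔸 →L[ℂ] 𝔸)) w := rfl
    rw [← h1, h2, Units.inv_mul, one_apply_eq_self]
  rw [hw, show ((u⁻¹ : (𝔸 →L[ℂ] 𝔸)ˣ) : 𝔸 →L[ℂ] 𝔸) y - y = (((u⁻¹ : (𝔸 →L[ℂ] 𝔸)ˣ) : 𝔸 →L[ℂ] 𝔸) - 1) y by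
    rw [sub_apply, one_apply_eq_self]]
  exact (ContinuousLinearMap.le_opNorm _ _).trans (mul_le_mul_of_nonneg_right hui (norm_nonneg _))

/-! ## §3 The rotation in `L²` -/

/-- `Σ_b ‖N(b₊)‖² = 3·Σ_x ‖N x‖²` (each site is the end-point of one bond per direction). [folklore] -/
theorem sum_normSq_tgt (N : Site (F.P K) 0 → Matrix (Fin 2) (Fin 2) ℂ) :
    ∑ b : PBond (F.P K) 0, ‖N b.tgt‖ ^ 2 = 3 * ∑ x : Site (F.P K) 0, ‖N x‖ ^ 2 := by
  have hB : (∑ x : Site (F.P K) 0, ∑ μ : Fin 3, ‖N (⟨x, μ⟩ : PBond (F.P K) 0).tgt‖ ^ 2) = ∑ b : PBond (F.P K) 0, ‖N b.tgt‖ ^ 2 :=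
    sum_site_dir_eq_sum_bond F (fun b => ‖N b.tgt‖ ^ 2)
  rw [← hB, Finset.sum_comm]
  have hμ : ∀ μ : Fin 3, ∑ x : Site (F.P K) 0, ‖N (⟨x, μ⟩ : PBond (F.P K) 0).tgt‖ ^ 2 = ∑ x : Site (F.P K) 0, ‖N x‖ ^ 2 := by
    intro μ
    obtain ⟨e, he⟩ := bnegEquiv_exists F (K := K) μ
    -- `x ↦ x + e_μ` is the inverse permutation of `e`
    refine Fintype.sum_equiv e.symm _ _ fun x => ?_
    show ‖N ((⟨x, μ⟩ : PBond (F.P K) 0).src.shift μ)‖ ^ 2 = ‖N (e.symm x)‖ ^ 2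
    have h1 : e (x.shift μ) = x := by rw [he, siteEquiv_shift, unshift_shift, Equiv.symm_apply_apply]
    have h2 : e.symm x = x.shift μ := by
      have := congrArg e.symm h1
      rw [Equiv.symm_apply_apply] at this
      exact this.symm
    rw [h2]
  simp only [hμ, Finset.sum_const, Finset.card_univ, Fintype.card_fin, nsmul_eq_mul, Nat.cast_ofNat]

/-- **THE ROTATION IS SMALL POINTWISE**: `‖e^{A(b)}U₀(b)N(b₊)U₀(b)⋆e^{−A(b)} − U₀(b)N(b₊)U₀(b)⋆‖ ≤ 2e^{εη}e^{εη}·εη·‖N(b₊)‖` for `‖A(b)‖ ≤ εη` (✓`norm_exp_conj_sub_self_le`, unitarity).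
[cite: Balaban1985Variational, (19) p.281] -/
theorem norm_rot_le (U₀ : GaugeField (F.P K) 0 (Matrix.specialUnitaryGroup (Fin 2) ℂ)) (A : PBond (F.P K) 0 → Matrix (Fin 2) (Fin 2) ℂ) {ε : ℝ}
    (hA0 : ∀ b, ‖A b‖ ≤ ε * eta F n K) (N : Site (F.P K) 0 → Matrix (Fin 2) (Fin 2) ℂ) (b : PBond (F.P K) 0) :
    ‖exp (A b) * (((U₀ b : Matrix.specialUnitaryGroup (Fin 2) ℂ) : Matrix (Fin 2) (Fin 2) ℂ) * N b.tgt * star (((U₀ b) : Matrix.specialUnitaryGroup (Fin 2) ℂ) : Matrix (Fin 2) (Fin 2) ℂ)) * exp (-(A b)) -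
        ((U₀ b : Matrix.specialUnitaryGroup (Fin 2) ℂ) : Matrix (Fin 2) (Fin 2) ℂ) * N b.tgt * star (((U₀ b) : Matrix.specialUnitaryGroup (Fin 2) ℂ) : Matrix (Fin 2) (Fin 2) ℂ)‖
      ≤ 2 * (Real.exp (ε * eta F n K) * Real.exp (ε * eta F n K)) * (ε * eta F n K) * ‖N b.tgt‖ := by
  have hn := norm_coe_bg F U₀ b
  have h1 := norm_exp_conj_sub_self_le (hA0 b) (((U₀ b : Matrix.specialUnitaryGroup (Fin 2) ℂ) : Matrix (Fin 2) (Fin 2) ℂ) * N b.tgt *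
    star (((U₀ b) : Matrix.specialUnitaryGroup (Fin 2) ℂ) : Matrix (Fin 2) (Fin 2) ℂ))
  have h2 : ‖((U₀ b : Matrix.specialUnitaryGroup (Fin 2) ℂ) : Matrix (Fin 2) (Fin 2) ℂ) * N b.tgt * star (((U₀ b) : Matrix.specialUnitaryGroup (Fin 2) ℂ) : Matrix (Fin 2) (Fin 2) ℂ)‖
      ≤ ‖N b.tgt‖ := by
    calc _ ≤ ‖((U₀ b : Matrix.specialUnitaryGroup (Fin 2) ℂ) : Matrix (Fin 2) (Fin 2) ℂ)‖ * ‖N b.tgt‖ * ‖star (((U₀ b) : Matrix.specialUnitaryGroup (Fin 2) ℂ) : Matrix (Fin 2) (Fin 2) ℂ)‖ :=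
          norm_mul₃_le
      _ = ‖N b.tgt‖ := by rw [hn.1, hn.2, one_mul, mul_one]
  have h3 : 0 ≤ 2 * (Real.exp (ε * eta F n K) * Real.exp (ε * eta F n K)) * ‖A b‖ := by positivity
  calc _ ≤ 2 * (Real.exp (ε * eta F n K) * Real.exp (ε * eta F n K)) * ‖A b‖ *
        ‖((U₀ b : Matrix.specialUnitaryGroup (Fin 2) ℂ) : Matrix (Fin 2) (Fin 2) ℂ) * N b.tgt * star (((U₀ b) : Matrix.specialUnitaryGroup (Fin 2) ℂ) : Matrix (Fin 2) (Fin 2) ℂ)‖ := h1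
    _ ≤ 2 * (Real.exp (ε * eta F n K) * Real.exp (ε * eta F n K)) * (ε * eta F n K) * ‖N b.tgt‖ := by
        have hεη : 0 ≤ ε * eta F n K := (norm_nonneg _).trans (hA0 b)
        have hX : 0 ≤ 2 * (Real.exp (ε * eta F n K) * Real.exp (ε * eta F n K)) := by positivity
        calc 2 * (Real.exp (ε * eta F n K) * Real.exp (ε * eta F n K)) * ‖A b‖ *
              ‖((U₀ b : Matrix.specialUnitaryGroup (Fin 2) ℂ) : Matrix (Fin 2) (Fin 2) ℂ) * N b.tgt * star (((U₀ b) : Matrix.specialUnitaryGroup (Fin 2) ℂ) : Matrix (Fin 2) (Fin 2) ℂ)‖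
            ≤ 2 * (Real.exp (ε * eta F n K) * Real.exp (ε * eta F n K)) * (ε * eta F n K) * ‖N b.tgt‖ :=
              mul_le_mul (mul_le_mul_of_nonneg_left (hA0 b) hX) h2 (norm_nonneg _) (mul_nonneg hX hεη)

/-- ★ **THE ROTATION IS SMALL IN `L²`**: `‖toL2(rot N)‖ ≤ 5e^{εη}e^{εη}·εη·‖toL2S N‖` (Frobenius ≤ √2·operator on bonds, `Σ_b‖N(b₊)‖² = 3Σ_x‖N x‖²`, operator ≤ Frobenius on sites; `2√6 ≤ 5`).
[cite: Balaban1985BackgroundPropagators, (3.11) p.392; Balaban1985Variational, (19) p.281] -/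
theorem norm_toL2_rot_le (U₀ : GaugeField (F.P K) 0 (Matrix.specialUnitaryGroup (Fin 2) ℂ)) (A : PBond (F.P K) 0 → Matrix (Fin 2) (Fin 2) ℂ) {ε : ℝ} (hε : 0 ≤ ε)
    (hA0 : ∀ b, ‖A b‖ ≤ ε * eta F n K) (N : Site (F.P K) 0 → Matrix (Fin 2) (Fin 2) ℂ) :
    ‖toL2 F K c₀ (fun b => exp (A b) * (((U₀ b : Matrix.specialUnitaryGroup (Fin 2) ℂ) : Matrix (Fin 2) (Fin 2) ℂ) * N b.tgt *
          star (((U₀ b) : Matrix.specialUnitaryGroup (Fin 2) ℂ) : Matrix (Fin 2) (Fin 2) ℂ)) * exp (-(A b)) -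
        ((U₀ b : Matrix.specialUnitaryGroup (Fin 2) ℂ) : Matrix (Fin 2) (Fin 2) ℂ) * N b.tgt * star (((U₀ b) : Matrix.specialUnitaryGroup (Fin 2) ℂ) : Matrix (Fin 2) (Fin 2) ℂ))‖
      ≤ 5 * (Real.exp (ε * eta F n K) * Real.exp (ε * eta F n K)) * (ε * eta F n K) * ‖toL2S F K c₀ N‖ := by
  have hc : 0 < c₀ := Fact.out
  have hη : 0 < eta F n K := eta_pos F n K
  set κ : ℝ := 2 * (Real.exp (ε * eta F n K) * Real.exp (ε * eta F n K)) * (ε * eta F n K) with hκ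
  have hκ0 : 0 ≤ κ := by positivity
  set R : PBond (F.P K) 0 → Matrix (Fin 2) (Fin 2) ℂ := fun b => exp (A b) * (((U₀ b : Matrix.specialUnitaryGroup (Fin 2) ℂ) : Matrix (Fin 2) (Fin 2) ℂ) * N b.tgt *
      star (((U₀ b) : Matrix.specialUnitaryGroup (Fin 2) ℂ) : Matrix (Fin 2) (Fin 2) ℂ)) * exp (-(A b)) -
    ((U₀ b : Matrix.specialUnitaryGroup (Fin 2) ℂ) : Matrix (Fin 2) (Fin 2) ℂ) * N b.tgt * star (((U₀ b) : Matrix.specialUnitaryGroup (Fin 2) ℂ) : Matrix (Fin 2) (Fin 2) ℂ) with hR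
  have hpt : ∀ b, ‖R b‖ ≤ κ * ‖N b.tgt‖ := fun b => norm_rot_le F U₀ A hA0 N b
  have hsq : ‖toL2 F K c₀ R‖ ^ 2 ≤ 6 * κ ^ 2 * (c₀ * ∑ x : Site (F.P K) 0, ‖N x‖ ^ 2) := by
    rw [normSq_toL2_eq]
    calc c₀ * ∑ b : PBond (F.P K) 0, ∑ j : Fin 2, ∑ k : Fin 2, ‖R b j k‖ ^ 2 ≤ c₀ * ∑ b : PBond (F.P K) 0, 2 * ‖R b‖ ^ 2 := by
          gcongr with b _
          have := sum_norm_sq_le_mul_opNorm_sq (N := 2) (R b)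
          simpa using this
      _ ≤ c₀ * ∑ b : PBond (F.P K) 0, 2 * (κ * ‖N b.tgt‖) ^ 2 := by
          gcongr with b _
          exact hpt b
      _ = 6 * κ ^ 2 * (c₀ * ∑ x : Site (F.P K) 0, ‖N x‖ ^ 2) := by
          have h1 : ∑ b : PBond (F.P K) 0, 2 * (κ * ‖N b.tgt‖) ^ 2 = 2 * κ ^ 2 * ∑ b : PBond (F.P K) 0, ‖N b.tgt‖ ^ 2 := by
            rw [Finset.mul_sum]; exact Finset.sum_congr rfl fun b _ => by ring
          rw [h1, sum_normSq_tgt]; ring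
  have hS : c₀ * ∑ x : Site (F.P K) 0, ‖N x‖ ^ 2 ≤ ‖toL2S F K c₀ N‖ ^ 2 := mul_sum_normSq_le_normSq_toL2S F N
  have hfin : ‖toL2 F K c₀ R‖ ^ 2 ≤ (5 * (Real.exp (ε * eta F n K) * Real.exp (ε * eta F n K)) * (ε * eta F n K) * ‖toL2S F K c₀ N‖) ^ 2 := by
    have h25 : (5 * (Real.exp (ε * eta F n K) * Real.exp (ε * eta F n K)) * (ε * eta F n K)) ^ 2 = (25 / 4) * κ ^ 2 := by rw [hκ]; ring
    calc ‖toL2 F K c₀ R‖ ^ 2 ≤ 6 * κ ^ 2 * (c₀ * ∑ x : Site (F.P K) 0, ‖N x‖ ^ 2) := hsq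
      _ ≤ 6 * κ ^ 2 * ‖toL2S F K c₀ N‖ ^ 2 := mul_le_mul_of_nonneg_left hS (by positivity)
      _ ≤ (25 / 4) * κ ^ 2 * ‖toL2S F K c₀ N‖ ^ 2 := by gcongr; norm_num
      _ = (5 * (Real.exp (ε * eta F n K) * Real.exp (ε * eta F n K)) * (ε * eta F n K) * ‖toL2S F K c₀ N‖) ^ 2 := by rw [hκ]; ring
  have hnn : 0 ≤ 5 * (Real.exp (ε * eta F n K) * Real.exp (ε * eta F n K)) * (ε * eta F n K) * ‖toL2S F K c₀ N‖ := by positivity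
  exact (pow_le_pow_iff_left₀ (norm_nonneg _) hnn two_ne_zero).1 hfin

/-! ## §4 The rotation row of the transfer supplier (hS) -/

/-- **`Gd N + η·D_{U₀}N = −rot N`** bondwise: `(N(b₋) − e^{A}U₀N(b₊)U₀⋆e^{−A}) + (U₀N(b₊)U₀⋆ − N(b₋)) = −(e^{A}U₀N(b₊)U₀⋆e^{−A} − U₀N(b₊)U₀⋆)` with `η·(toL2⁻¹ D_{U₀} toL2S N)(b) =
U₀(b)N(b₊)U₀(b)⋆ − N(b₋)` (✓`DL2_apply`). [cite: Balaban1985BackgroundPropagators, (3.3) p.391] -/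
theorem gaugeDir_add_eta_smul_eq_neg_rot (U₀ : GaugeField (F.P K) 0 (Matrix.specialUnitaryGroup (Fin 2) ℂ)) (A : PBond (F.P K) 0 → Matrix (Fin 2) (Fin 2) ℂ)
    (N : Site (F.P K) 0 → Matrix (Fin 2) (Fin 2) ℂ) (b : PBond (F.P K) 0) :
    (N b.src - exp (A b) * (((U₀ b : Matrix.specialUnitaryGroup (Fin 2) ℂ) : Matrix (Fin 2) (Fin 2) ℂ) * N b.tgt * star (((U₀ b) : Matrix.specialUnitaryGroup (Fin 2) ℂ) : Matrix (Fin 2) (Fin 2) ℂ)) *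
        exp (-(A b))) + ((eta F n K : ℝ) : ℂ) • (toL2 F K c₀).symm (DL2 F n K c₀ U₀ (toL2S F K c₀ N)) b
      = -(exp (A b) * (((U₀ b : Matrix.specialUnitaryGroup (Fin 2) ℂ) : Matrix (Fin 2) (Fin 2) ℂ) * N b.tgt * star (((U₀ b) : Matrix.specialUnitaryGroup (Fin 2) ℂ) : Matrix (Fin 2) (Fin 2) ℂ)) *
          exp (-(A b)) - ((U₀ b : Matrix.specialUnitaryGroup (Fin 2) ℂ) : Matrix (Fin 2) (Fin 2) ℂ) * N b.tgt * star (((U₀ b) : Matrix.specialUnitaryGroup (Fin 2) ℂ) : Matrix (Fin 2) (Fin 2) ℂ)) := by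
  have hη : 0 < eta F n K := eta_pos F n K
  have hη' : ((eta F n K : ℝ) : ℂ) ≠ 0 := by exact_mod_cast hη.ne'
  rw [DL2_apply, coe_bgOfCfg_inv, Equiv.symm_apply_apply, smul_smul, mul_inv_cancel₀ hη', one_smul]
  abel

/-- ★★★ **THE ROTATION ROW OF (hS)**: for `w` with `g(ad(−A(b)))·w(b) = Gd N(b)` (the consumer's pulled gauge direction at `U′ = e^{A}U₀`), under `0 ≤ ε`, `‖A(b)‖ ≤ εη ≤ ¼` and DIAGONAL covariant
gradients `‖(∇_{U₀}A)_{μμ}‖ ≤ εη²`: `‖D*_{U₀}(toL2 w + η·D_{U₀}(toL2S N))‖ ≤ e^{εη}e^{εη}·ε·η·((12 + 100ε)·‖toL2S N‖ + 28·‖D_{U₀}(toL2S N)‖)` — the shape `η·a′·(‖N‖ + ‖DN‖)` of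
✓`Prop7LandauTransversalityPairing.htest_of_suppliers`'s (hS) with `a′` L-only. [cite: Balaban1985BackgroundPropagators, (3.3) p.391, (3.8) p.392; Balaban1985Variational, (19) p.281, (47)–(49) p.285] -/
theorem norm_DstarL2_transfer_le (U₀ : GaugeField (F.P K) 0 (Matrix.specialUnitaryGroup (Fin 2) ℂ)) (A : PBond (F.P K) 0 → Matrix (Fin 2) (Fin 2) ℂ) {ε : ℝ} (hε : 0 ≤ ε)
    (hA0 : ∀ b, ‖A b‖ ≤ ε * eta F n K) (hεη : ε * eta F n K ≤ 1 / 4)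
    (hA1 : ∀ (μ : Fin 3) (x : Site (F.P K) 0), ‖covGradT 1 (bgUnits F K U₀) A μ μ x‖ ≤ ε * eta F n K ^ 2)
    (N : Site (F.P K) 0 → Matrix (Fin 2) (Fin 2) ℂ) (w : PBond (F.P K) 0 → Matrix (Fin 2) (Fin 2) ℂ)
    (hw : ∀ b, gSer ℂ (ad ℂ (-(A b))) (w b) = N b.src - exp (A b) * (((U₀ b : Matrix.specialUnitaryGroup (Fin 2) ℂ) : Matrix (Fin 2) (Fin 2) ℂ) * N b.tgt *
        star (((U₀ b) : Matrix.specialUnitaryGroup (Fin 2) ℂ) : Matrix (Fin 2) (Fin 2) ℂ)) * exp (-(A b))) :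
    ‖DstarL2 F n K c₀ U₀ (toL2 F K c₀ w + ((eta F n K : ℝ) : ℂ) • DL2 F n K c₀ U₀ (toL2S F K c₀ N))‖
      ≤ (Real.exp (ε * eta F n K) * Real.exp (ε * eta F n K)) * ε * eta F n K *
          ((12 + 100 * ε) * ‖toL2S F K c₀ N‖ + 28 * ‖DL2 F n K c₀ U₀ (toL2S F K c₀ N)‖) := by
  have hη : 0 < eta F n K := eta_pos F n K
  set X : ℝ := Real.exp (ε * eta F n K) * Real.exp (ε * eta F n K) with hX
  have hX1 : 1 ≤ X := by
    have h1 : 1 ≤ Real.exp (ε * eta F n K) := Real.one_le_exp (by positivity)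
    nlinarith
  set a : ℝ := ‖toL2S F K c₀ N‖ with ha
  set d : ℝ := ‖DL2 F n K c₀ U₀ (toL2S F K c₀ N)‖ with hd
  -- the three fields
  set Gd : PBond (F.P K) 0 → Matrix (Fin 2) (Fin 2) ℂ := fun b => N b.src - exp (A b) * (((U₀ b : Matrix.specialUnitaryGroup (Fin 2) ℂ) : Matrix (Fin 2) (Fin 2) ℂ) * N b.tgt *
      star (((U₀ b) : Matrix.specialUnitaryGroup (Fin 2) ℂ) : Matrix (Fin 2) (Fin 2) ℂ)) * exp (-(A b)) with hGd
  set R : PBond (F.P K) 0 → Matrix (Fin 2) (Fin 2) ℂ := fun b => exp (A b) * (((U₀ b : Matrix.specialUnitaryGroup (Fin 2) ℂ) : Matrix (Fin 2) (Fin 2) ℂ) * N b.tgt *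
      star (((U₀ b) : Matrix.specialUnitaryGroup (Fin 2) ℂ) : Matrix (Fin 2) (Fin 2) ℂ)) * exp (-(A b)) -
    ((U₀ b : Matrix.specialUnitaryGroup (Fin 2) ℂ) : Matrix (Fin 2) (Fin 2) ℂ) * N b.tgt * star (((U₀ b) : Matrix.specialUnitaryGroup (Fin 2) ℂ) : Matrix (Fin 2) (Fin 2) ℂ) with hR
  -- the identity `toL2 w + η•D N = toL2 (w − Gd) − toL2 R`
  have hid : toL2 F K c₀ w + ((eta F n K : ℝ) : ℂ) • DL2 F n K c₀ U₀ (toL2S F K c₀ N) = toL2 F K c₀ (w - Gd) - toL2 F K c₀ R := by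
    have h1 : ((eta F n K : ℝ) : ℂ) • DL2 F n K c₀ U₀ (toL2S F K c₀ N) = toL2 F K c₀ (((eta F n K : ℝ) : ℂ) • (toL2 F K c₀).symm (DL2 F n K c₀ U₀ (toL2S F K c₀ N))) := by
      rw [map_smul, LinearEquiv.apply_symm_apply]
    have h2 : Gd + ((eta F n K : ℝ) : ℂ) • (toL2 F K c₀).symm (DL2 F n K c₀ U₀ (toL2S F K c₀ N)) = -R := by
      funext b
      simp only [Pi.add_apply, Pi.smul_apply, Pi.neg_apply, hGd, hR]
      exact gaugeDir_add_eta_smul_eq_neg_rot F U₀ A N b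
    rw [h1, ← map_sub, ← map_add]
    congr 1
    have : w + ((eta F n K : ℝ) : ℂ) • (toL2 F K c₀).symm (DL2 F n K c₀ U₀ (toL2S F K c₀ N)) = (w - Gd) + (Gd + ((eta F n K : ℝ) : ℂ) • (toL2 F K c₀).symm (DL2 F n K c₀ U₀ (toL2S F K c₀ N))) := by abel
    rw [this, h2]
    abel
  -- the velocity defect, bondwise: `‖w − Gd‖ ≤ 4εη‖Gd‖`
  have hdef : ∀ b, ‖(w - Gd) b‖ ≤ 4 * (ε * eta F n K) * ‖Gd b‖ := fun b => by
    rw [Pi.sub_apply]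
    exact norm_velocityDefect_le (hA0 b) hεη (hw b)
  have h4 : 0 ≤ 4 * (ε * eta F n K) := by positivity
  have hD1 : ‖DstarL2 F n K c₀ U₀ (toL2 F K c₀ (w - Gd))‖ ≤ 5 * (4 * (ε * eta F n K)) * (eta F n K)⁻¹ * ‖toL2 F K c₀ Gd‖ :=
    norm_DstarL2_le_of_pointwise F U₀ (w - Gd) Gd h4 hdef
  -- `‖toL2 Gd‖ ≤ η d + 5Xεη a`
  have hGdn : ‖toL2 F K c₀ Gd‖ ≤ eta F n K * d + 5 * X * (ε * eta F n K) * a := by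
    have h1 : toL2 F K c₀ Gd = -(((eta F n K : ℝ) : ℂ) • DL2 F n K c₀ U₀ (toL2S F K c₀ N)) - toL2 F K c₀ R := by
      have h2 : Gd = -(((eta F n K : ℝ) : ℂ) • (toL2 F K c₀).symm (DL2 F n K c₀ U₀ (toL2S F K c₀ N))) - R := by
        funext b
        have := gaugeDir_add_eta_smul_eq_neg_rot F (n := n) (c₀ := c₀) U₀ A N b
        simp only [Pi.sub_apply, Pi.neg_apply, Pi.smul_apply, hGd, hR]
        rw [← sub_eq_zero]
        have h3 := sub_eq_zero.2 this
        rw [← h3]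
        abel
      rw [h2, map_sub, map_neg, map_smul, LinearEquiv.apply_symm_apply]
    rw [h1]
    calc ‖-(((eta F n K : ℝ) : ℂ) • DL2 F n K c₀ U₀ (toL2S F K c₀ N)) - toL2 F K c₀ R‖
        ≤ ‖-(((eta F n K : ℝ) : ℂ) • DL2 F n K c₀ U₀ (toL2S F K c₀ N))‖ + ‖toL2 F K c₀ R‖ := norm_sub_le _ _
      _ ≤ eta F n K * d + 5 * X * (ε * eta F n K) * a := by
          rw [norm_neg, norm_smul, Complex.norm_real, Real.norm_of_nonneg hη.le]
          exact add_le_add le_rfl (norm_toL2_rot_le F U₀ A hε hA0 N)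
  have hD2 : ‖DstarL2 F n K c₀ U₀ (toL2 F K c₀ R)‖ ≤ 2 * X * ε * eta F n K * (6 * a + 4 * d) := norm_DstarL2_rot_le F U₀ A hε hA0 hA1 N
  -- assemble
  rw [hid, map_sub]
  have hεη0 : 0 ≤ ε * eta F n K := by positivity
  have ha0 : 0 ≤ a := norm_nonneg _
  have hd0 : 0 ≤ d := norm_nonneg _
  calc ‖DstarL2 F n K c₀ U₀ (toL2 F K c₀ (w - Gd)) - DstarL2 F n K c₀ U₀ (toL2 F K c₀ R)‖
      ≤ ‖DstarL2 F n K c₀ U₀ (toL2 F K c₀ (w - Gd))‖ + ‖DstarL2 F n K c₀ U₀ (toL2 F K c₀ R)‖ := norm_sub_le _ _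
    _ ≤ 5 * (4 * (ε * eta F n K)) * (eta F n K)⁻¹ * (eta F n K * d + 5 * X * (ε * eta F n K) * a) + 2 * X * ε * eta F n K * (6 * a + 4 * d) := by
        refine add_le_add (hD1.trans ?_) hD2
        exact mul_le_mul_of_nonneg_left hGdn (by positivity)
    _ = ε * eta F n K * (20 * d + 100 * X * ε * a + 12 * X * a + 8 * X * d) := by field_simp; ring
    _ ≤ ε * eta F n K * (20 * X * d + 100 * X * ε * a + 12 * X * a + 8 * X * d) := by
        gcongr
        nlinarith
    _ = X * ε * eta F n K * ((12 + 100 * ε) * a + 28 * d) := by ring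

end Summit.QuantumFields.YangMills.Theorems.Prop7GaugeDirRotationDivergence

end
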